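import Summits.QuantumFields.YangMills.Theorems.RationalShortRootRigidityNoU3Rescaling
import Summits.QuantumFields.YangMills.Theorems.RationalShortRootRigidityRootsClosedLimit
import HarnessLib

/-!
# `RationalShortRootRigidity` — Step 2 assembly helper (§E of the `stub_planar` plan): the top form has imaginary roots

Helper lemma INSIDE the paper proof of crux `stmt-QuantumFields-23124` (`F4SubCurvatureDoor.RationalShortRootRigidity`,
LINE g15-A of planner ym-idea-3; owner's assembly plan HOME l15/STUB-PLAN-Planar.md §E — the analytic input that feeds the third
hypothesis of `mobiusTopForm` (p665007)):

**Lemma** (`topForm_roots_imaginary`).  Let `b ∈ ℝ[x,y]` have total degree `≤ N` and non-zero `x^N`-coefficient, and suppose that for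
every real `y` all complex roots `z` of `b(z, y)` are purely imaginary.  Then all complex roots `t` of `T(t, 1)` are purely imaginary,
where `T = homogeneousComponent N b` is the top form.

Proof.  `T(t,1) = lim_{n→∞} n^{−N} b(nt, n)` coefficientwise: the rescaled polynomials `P_n(t) = Σ_d b_d t^{d₀} (n+1)^{|d|−N}` have degree
exactly `N` (leading coefficient the `x^N`-coefficient), roots `t = z/(n+1)` purely imaginary, and converge to `Σ_{|d|=N} b_d t^{d₀}`;
`rootsInClosedSetLimit` (p666193) with the closed set `{Re = 0}`.

Mathlib + tree helpers (`tendsto_inv_succ_pow` p667646, `rootsInClosedSetLimit` p666193); THEOREMS ONLY; no named facts; no `sorry`;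
default heartbeats.  Nothing about the crux 23124, the route's rung or the Yang–Mills mass gap is proved here.  Free-hands seat
`ym-line-frs-p2` g10, `--supports stmt-QuantumFields-23124`.
-/

set_option autoImplicit false

namespace Summit.QuantumFields.YangMills.Theorems.RationalShortRootRigidity

open Filter Topology Polynomial
open scoped BigOperators Polynomial

/-- **The top form has purely imaginary roots** (STUB-PLAN-Planar §E). [folklore] -/
theorem topForm_roots_imaginary (b : MvPolynomial (Fin 2) ℝ) (N : ℕ) (hdeg : b.totalDegree ≤ N)
    (hc : MvPolynomial.coeff (Finsupp.single 0 N) b ≠ 0)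
    (hW : ∀ (y : ℝ) (z : ℂ), MvPolynomial.aeval (fun i : Fin 2 => if i = 0 then z else (y : ℂ)) b = 0 → z.re = 0) :
    ∀ t : ℂ, MvPolynomial.aeval (fun i : Fin 2 => if i = 0 then t else (1 : ℂ)) (MvPolynomial.homogeneousComponent N b) = 0 →
      t.re = 0 := by
  classical
  -- degrees of support exponents
  have hdegd : ∀ d ∈ b.support, d.degree ≤ N := by
    intro d hd
    have h1 := MvPolynomial.le_totalDegree hd
    rw [Finsupp.sum_fintype _ _ (fun _ => rfl)] at h1
    rw [Finsupp.degree_eq_sum]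
    exact h1.trans hdeg
  have hd0 : ∀ d ∈ b.support, d 0 ≤ d.degree := fun d _ => by
    rw [Finsupp.degree_eq_sum, Fin.sum_univ_two]; exact Nat.le_add_right _ _
  have hsingle : ∀ d ∈ b.support, d 0 = N → d = Finsupp.single 0 N := by
    intro d hd h0
    have h1 := hdegd d hd
    rw [Finsupp.degree_eq_sum, Fin.sum_univ_two] at h1
    ext j
    fin_cases j
    · simpa using h0
    · simp; omega
  -- the real rescaled family and its limit
  set P : ℕ → ℝ[X] := fun n => ∑ d ∈ b.support,
    Polynomial.C (MvPolynomial.coeff d b * (((n : ℝ) + 1)⁻¹) ^ (N - d.degree)) * X ^ (d 0) with hP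
  set Q : ℝ[X] := ∑ d ∈ b.support, Polynomial.C (if d.degree = N then MvPolynomial.coeff d b else 0) * X ^ (d 0) with hQ
  -- coefficients
  have hPcoeff : ∀ n i, (P n).coeff i =
      ∑ d ∈ b.support, if i = d 0 then MvPolynomial.coeff d b * (((n : ℝ) + 1)⁻¹) ^ (N - d.degree) else 0 := by
    intro n i; rw [hP]; simp only [finsetSum_coeff, coeff_C_mul_X_pow]
  have hQcoeff : ∀ i, Q.coeff i = ∑ d ∈ b.support, if i = d 0 then (if d.degree = N then MvPolynomial.coeff d b else 0) else 0 := by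
    intro i; rw [hQ]; simp only [finsetSum_coeff, coeff_C_mul_X_pow]
  have hPtop : ∀ n, (P n).coeff N = MvPolynomial.coeff (Finsupp.single 0 N) b := by
    intro n
    rw [hPcoeff, Finset.sum_eq_single (Finsupp.single 0 N)]
    · simp
    · intro d hd hne
      rw [if_neg]
      intro h; exact hne (hsingle d hd h.symm)
    · intro h; rw [MvPolynomial.notMem_support_iff.1 h]; simp
  have hQtop : Q.coeff N = MvPolynomial.coeff (Finsupp.single 0 N) b := by
    rw [hQcoeff, Finset.sum_eq_single (Finsupp.single 0 N)]
    · simp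
    · intro d hd hne
      rw [if_neg]
      intro h; exact hne (hsingle d hd h.symm)
    · intro h; rw [MvPolynomial.notMem_support_iff.1 h]; simp
  have hPdeg : ∀ n, (P n).natDegree = N := by
    intro n
    refine le_antisymm ?_ (le_natDegree_of_ne_zero (by rw [hPtop]; exact hc))
    rw [hP]
    refine natDegree_sum_le_of_forall_le _ _ fun d hd => (natDegree_C_mul_X_pow_le _ _).trans ((hd0 d hd).trans (hdegd d hd))
  have hQdeg : Q.natDegree = N := by
    refine le_antisymm ?_ (le_natDegree_of_ne_zero (by rw [hQtop]; exact hc))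
    rw [hQ]
    refine natDegree_sum_le_of_forall_le _ _ fun d hd => (natDegree_C_mul_X_pow_le _ _).trans ((hd0 d hd).trans (hdegd d hd))
  have hQ0 : Q ≠ 0 := fun h => hc (by rw [← hQtop, h, coeff_zero])
  -- complex versions
  set p : ℕ → ℂ[X] := fun n => (P n).map (algebraMap ℝ ℂ) with hp
  set q : ℂ[X] := Q.map (algebraMap ℝ ℂ) with hq
  have hinj : Function.Injective (algebraMap ℝ ℂ) := (algebraMap ℝ ℂ).injective
  have hpdeg : ∀ n, (p n).natDegree = N := fun n => by rw [hp]; simp only []; rw [natDegree_map_eq_of_injective hinj, hPdeg]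
  have hqdeg : q.natDegree = N := by rw [hq, natDegree_map_eq_of_injective hinj, hQdeg]
  have hq0 : q ≠ 0 := by rw [hq]; exact (Polynomial.map_ne_zero_iff hinj).2 hQ0
  have hcoef : ∀ i : ℕ, Tendsto (fun n => (p n).coeff i) atTop (𝓝 (q.coeff i)) := by
    intro i
    have h1 : ∀ n, (p n).coeff i = ((P n).coeff i : ℂ) := fun n => by rw [hp]; simp only [coeff_map]; rfl
    have h2 : q.coeff i = (Q.coeff i : ℂ) := by rw [hq, coeff_map]; rfl
    simp_rw [h1, h2, hPcoeff, hQcoeff]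
    push_cast
    refine tendsto_finsetSum _ fun d _ => ?_
    by_cases hi : i = d 0
    · simp only [if_pos hi]
      have h3 := ((Complex.continuous_ofReal.tendsto _).comp
        ((tendsto_inv_succ_pow (N - d.degree)).const_mul (MvPolynomial.coeff d b)))
      refine Tendsto.congr (fun n => ?_) (h3.trans ?_)
      · simp only [Function.comp_apply]
      · by_cases hdN : d.degree = N
        · simp [hdN]
        · have : N - d.degree ≠ 0 := by
            intro h; exact hdN (le_antisymm (hdegd d ‹_›) (Nat.sub_eq_zero_iff_le.1 h))
          simp [this, hdN]
    · simp only [if_neg hi]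
      exact tendsto_const_nhds
  -- roots of `p n` are purely imaginary
  have hS : IsClosed {z : ℂ | z.re = 0} := isClosed_eq Complex.continuous_re continuous_const
  have hproots : ∀ n, ∀ z : ℂ, (p n).IsRoot z → z ∈ {z : ℂ | z.re = 0} := by
    intro n z hz
    set y : ℝ := (n : ℝ) + 1 with hy
    have hy0 : y ≠ 0 := by positivity
    -- `b(z·y, y) = y^N · P_n(z)`
    have hid : MvPolynomial.aeval (fun i : Fin 2 => if i = 0 then z * (y : ℂ) else (y : ℂ)) b =
        (y : ℂ) ^ N * (p n).eval z := by
      rw [hp]; simp only []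
      rw [eval_map, ← aeval_def, hP]; simp only []
      rw [map_sum, MvPolynomial.aeval_def, MvPolynomial.eval₂_eq', Finset.mul_sum]
      refine Finset.sum_congr rfl fun d hd => ?_
      rw [Fin.prod_univ_two, if_pos rfl, if_neg (by decide : ¬ ((1 : Fin 2) = 0)), map_mul, aeval_C, map_pow, aeval_X,
        Complex.coe_algebraMap]
      push_cast
      have hdd : d.degree = d 0 + d 1 := by rw [Finsupp.degree_eq_sum, Fin.sum_univ_two]
      obtain ⟨m, hm⟩ : ∃ m, N = d.degree + m := ⟨N - d.degree, by have := hdegd d hd; omega⟩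
      rw [hm, Nat.add_sub_cancel_left, hdd, pow_add, pow_add, mul_pow]
      have hyinv : ((y : ℂ))⁻¹ ^ m * (y : ℂ) ^ m = 1 := by
        rw [← mul_pow, inv_mul_cancel₀ (Complex.ofReal_ne_zero.2 hy0), one_pow]
      rw [show ((n : ℂ) + 1) = (y : ℂ) by rw [hy]; push_cast; ring]
      linear_combination (-((↑(MvPolynomial.coeff d b) : ℂ) * z ^ (d 0) * (y : ℂ) ^ (d 0) * (y : ℂ) ^ (d 1))) * hyinv
    have hzero : MvPolynomial.aeval (fun i : Fin 2 => if i = 0 then z * (y : ℂ) else (y : ℂ)) b = 0 := by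
      rw [hid, hz.eq_zero, mul_zero]
    have := hW y (z * y) hzero
    rw [Complex.mul_re, Complex.ofReal_re, Complex.ofReal_im, mul_zero, sub_zero] at this
    exact (mul_eq_zero.1 this).resolve_right hy0
  have hqroots := rootsInClosedSetLimit {z : ℂ | z.re = 0} hS N p q hpdeg hqdeg hq0 hcoef hproots
  -- `T(t,1) = q(t)`
  intro t ht
  apply hqroots t
  rw [IsRoot.def, hq, eval_map, ← aeval_def, hQ, map_sum]
  rw [MvPolynomial.homogeneousComponent_apply, map_sum, Finset.sum_filter] at ht
  rw [← ht]
  refine Finset.sum_congr rfl fun d _ => ?_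
  rw [map_mul, aeval_C, map_pow, aeval_X, Complex.coe_algebraMap]
  split_ifs with h
  · rw [MvPolynomial.aeval_monomial, Finsupp.prod_pow, Fin.prod_univ_two, Complex.coe_algebraMap]
    simp
  · simp

end Summit.QuantumFields.YangMills.Theorems.RationalShortRootRigidity
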